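import Literature.Barriers.MatrixMultiplication.NormalizerBarrierSubsets
import HarnessLib

/-!
# A TPP triple of SUBSETS with a normal member is trivial (Murthy 2026, Prop. 2.6 (2), subset form; via BCGPU 2023, Rem. 3.7)

Topic `Literature/Computability/AlgebraicComplexity` (group-theoretic matrix multiplication; the
tree's right-quotient `TripleProductProperty` of `Literature/Combinatorics/Additive/TripleProductProperty.lean`;
companion of `SubgroupTPPQuotient.lean`, whose `Murthy2026_prop26_2_subgroup` is the SUBGROUP form, and of
`Literature/Barriers/MatrixMultiplication/NormalizerBarrierSubsets.lean`, BCGPU 2023 Rem. 3.7).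

S. R. Murthy, *On the triple product property for subgroups of finite nilpotent groups of class 2*,
arXiv:2602.15796v1 (2026), Prop. 2.6, p. 5, verbatim (a "TPP triple of a group `G`" is a triple of
SUBSETS; `N_G(X) = {g : gXg⁻¹ = X}`):

> **Proposition 2.6.** Let `(S, T, U)` be a non-trivial TPP triple of a group `G`, that is, one such
> that `|S||T||U| > |G|`. Then […] (2) No member `S, T, U` is normalised by (or, in particular,
> centralised by) by `G` or by each other, that is, `N_G(X) < G` for any `X ∈ {S, T, U}` […].
> *Proof.* […] (2) Let `S` be normalised by `G`, that is, `N_G(S) = G`. Then `S` permutes with `T` and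
> `T⁻¹`, and by part (1) `|S||T||U| ≤ |G|`, a contradiction. […]

J. Blasiak, H. Cohn, J. A. Grochow, K. Pratt, C. Umans, ITCS 2023 (arXiv:2204.03826), Rem. 3.7 (p. 7):
"The same proof in fact works for subsets `S,T,U` satisfying the triple product property, not just
subgroups, and leads to the conclusion that
`|S||T||U| ≤ (|G|³/(|N(Q(S)) ∩ T| |N(Q(T)) ∩ U| |N(Q(U)) ∩ S|))^{1/2}`" — in the tree as
`tpp_card_mul_card_normalizer_quot_mul_card_le` (`|S| · |N(Q(U)) ∩ T| · |U| ≤ |G|`) and `BCGPU2023_rem37_sq`.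

## What is here (all proved; 0 definitions, 0 named facts)

* `tpp_card_mul_le_of_normalizer_quot_eq_top` — **Rem. 3.7 with a normal quotient set**: if
  `Q(U) = {u u'⁻¹}` is normalised by all of `G` then `|N(Q(U)) ∩ T| = |T|` and the main observation
  reads `|S| |T| |U| ≤ |G|`;
* `Murthy2026_prop26_2_subset` — **Prop. 2.6 (2), subset form** (contrapositive of "`N_G(X) < G`"):
  if the member `S` is a normal subset (`g S g⁻¹ ⊆ S` for all `g`), then `Q(S)` is normalised by `G`
  and, by the previous item for the reversed triple `(U, T, S)`, `|S| |T| |U| ≤ |G|`.  This route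
  (through Rem. 3.7) replaces the note's own (through its Prop. 2.6 (1), whose closing step
  `|ST| = |S||T|` is not spelled out for subsets in the right-quotient convention; the subgroup form of
  (1) is `Murthy2026_prop26_1_subgroup` in `SubgroupTPPPermutability.lean`).

Census reading (pub-omega, family (b), SUBSET triples): a search may discard every candidate member
that is a normal subset (a union of conjugacy classes, e.g. any central subset), and more generally
any member `U` whose quotient set `Q(U)` is normal.

## References
* S. R. Murthy, arXiv:2602.15796v1 (2026): Prop. 2.6 (2) with proof, p. 5. [Murthy2026]
* J. Blasiak, H. Cohn, J. A. Grochow, K. Pratt, C. Umans, *Matrix multiplication via matrix groups*,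
  ITCS 2023: Thm. 3.6 (proof) and Rem. 3.7, p. 7. [BlasiakCohnGrochowPrattUmans2023]
-/

namespace Literature.Computability.AlgebraicComplexity

open Finset Literature.Combinatorics.Additive Literature.Barriers.MatrixMultiplication

variable {G : Type*} [Group G]

/-- **BCGPU 2023, Rem. 3.7 with a normal quotient set**: for a TPP triple `(S, T, U)` of subsets of a
finite group, if `Q(U) = {u u'⁻¹ : u, u' ∈ U}` is normalised by every element of `G`
(`N(Q(U)) = G`), then `|S| |T| |U| ≤ |G|` — the triple is trivial.
[cite: BlasiakCohnGrochowPrattUmans2023, Rem. 3.7] -/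
theorem tpp_card_mul_le_of_normalizer_quot_eq_top [Fintype G] [DecidableEq G] {S T U : Finset G}
    (h : TripleProductProperty S T U)
    (hN : Subgroup.normalizer {g : G | ∃ u ∈ U, ∃ u' ∈ U, u * u'⁻¹ = g} = ⊤) :
    S.card * T.card * U.card ≤ Fintype.card G := by
  classical
  have hle := tpp_card_mul_card_normalizer_quot_mul_card_le h
  have hT : T.filter (· ∈ Subgroup.normalizer {g : G | ∃ u ∈ U, ∃ u' ∈ U, u * u'⁻¹ = g}) = T :=
    Finset.filter_true_of_mem fun t _ => by rw [hN]; exact Subgroup.mem_top t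
  rw [hT] at hle
  convert hle

/-- **Murthy 2026, Prop. 2.6 (2), subset form** ("No member `S, T, U` is normalised by … `G`", i.e.
`N_G(X) < G` for every member of a non-trivial TPP triple of subsets; contrapositive): if the member
`S` of a TPP triple of subsets of a finite group is a normal subset (`g s g⁻¹ ∈ S` for all `g ∈ G`,
`s ∈ S`), then `|S| |T| |U| ≤ |G|`.  Proof: `Q(S)` is then normalised by `G`, and Rem. 3.7's main
observation for the reversed triple `(U, T, S)` gives `|U| · |T| · |S| ≤ |G|`.
[cite: Murthy2026, Prop. 2.6 (2)] [cite: BlasiakCohnGrochowPrattUmans2023, Rem. 3.7] -/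
theorem Murthy2026_prop26_2_subset [Fintype G] [DecidableEq G] {S T U : Finset G}
    (h : TripleProductProperty S T U) (hS : ∀ g : G, ∀ s ∈ S, g * s * g⁻¹ ∈ S) :
    S.card * T.card * U.card ≤ Fintype.card G := by
  -- `Q(S)` is mapped into itself by every conjugation
  have hfwd : ∀ g n : G, n ∈ {x : G | ∃ s ∈ S, ∃ s' ∈ S, s * s'⁻¹ = x} →
      g * n * g⁻¹ ∈ {x : G | ∃ s ∈ S, ∃ s' ∈ S, s * s'⁻¹ = x} := by
    rintro g n ⟨s, hs, s', hs', rfl⟩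
    exact ⟨g * s * g⁻¹, hS g s hs, g * s' * g⁻¹, hS g s' hs', by group⟩
  -- hence `N(Q(S)) = G`
  have hN : Subgroup.normalizer {x : G | ∃ s ∈ S, ∃ s' ∈ S, s * s'⁻¹ = x} = ⊤ := by
    refine (Subgroup.eq_top_iff' _).2 fun g => Subgroup.mem_set_normalizer_iff.2 fun n => ⟨hfwd g n, ?_⟩
    intro hn
    have := hfwd g⁻¹ _ hn
    simpa only [inv_inv, mul_assoc, inv_mul_cancel_left, inv_mul_cancel, mul_one] using this
  have hle := tpp_card_mul_le_of_normalizer_quot_eq_top h.reverse hN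
  calc S.card * T.card * U.card = U.card * T.card * S.card := by ring
    _ ≤ Fintype.card G := hle

end Literature.Computability.AlgebraicComplexity
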